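/-
Copyright (c) 2026 the pub-hodgecm-mathlib formalisation cell (harness21).  Prover seat hodgecm-mathlib-A-p12 (g21), 2026-09-01.  Road «S3-tree» (architect A-p16 (g29)), brick T3′
«depth-zero κ-transfer», assembly row (P-1) (holder F0P3b-p01 (g12)), its LAST MILE «ROW-0 PER LITERAL»: `n₀(t) = φ₁(Q₁−1, P−1)` ∕ `φ₀(Q₁−1, Q₂−1, P−1)`.
-/
import Literature.NumberTheory.Rogawski1990.DepthZeroKappaTransferCayleyLiteral        -- ★ FILE B (this seat): the Cayley literal `t′`, `n₀(t) = #Fix(t′)` (brings ★ p846155, ★ p846223, ★ FILE A)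
import HarnessLib

/-!
# The depth-zero κ-transfer, type (1): ROW 0 per literal — `n₀(t_π(x)) = φ₁(Q₁ − 1, P − 1)`, `n₀(t_1(x)) = φ₀(Q₁ − 1, Q₂ − 1, P − 1)`
# (Rogawski 1990 Prop. 4.9.1 (b); Kottwitz 1986 §3; Flicker 1998 Props. 11, 14)

Topic `NumberTheory/Rogawski1990`; namespace `Literature.NumberTheory.Rogawski1990`.  THEOREMS ONLY (no definition, no instance, no notation, no named fact,
no `sorry`); kernel lane `--supports stmt-HodgeConjecture-24833`.  Cell `pub/hodgecm-mathlib` (D-0151); road «S3-tree», brick T3′ «DEPTH-ZERO κ-TRANSFER»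
(DESIGN v2), assembly row (P-1) `depthZeroKappaTransfer_hyperspecial_typeOne` (holder F0P3b-p01 (g12)), the LAST MILE of its census row (i): the residually
trivial stratum count `n₀(t)` of ★ `classOrbitalIntegral_eq_mul_strata_three_of_deep` (O8b FILE 3) at Flicker's literals, in the binders of ★
`sum_ncard_rankStrata_eq_phiOne_of_congr` ∕ `sum_ncard_rankStrata_eq_phiZero_of_congr` (★ p846155) VERBATIM.

THE MATHEMATICS (Kottwitz's level shift, [Rogawski1990, §4.9 p. 54]).  Let `t ∈ G′_v = U(H′)(L⁺_v)` be congruent (`ψ g = Tl g Tl⁻¹`) to a θ̄ = 1 literal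
`t_π(x₁,x₂,x₃) = (D_π h)·diag(x)·(D_π h)⁻¹` with norm-one eigenvalues `x_i ≡ 1 (mod 𝔪_w)` at distances `|x₁−x₃| = q_w^{−P}`, `|x₁−x₂| = q_w^{−Q₁}`, `|x₃−x₂| = q_w^{−Q₂}`.
With a `σ_w`-fixed uniformiser `ϖ` (★ `localConjDatum_adicCompletion`, `v` unramified, `v ∤ 2`) put `Z_i = ϖ⁻¹(x_i−1)(x_i+1)⁻¹` (skew: `σ Z_i = −Z_i`, ★ CAYLEY) and
`Y_i = (1+Z_i)(1−Z_i)⁻¹` (norm one, `|Y_i − Y_j| = |x_i − x_j|∕|ϖ|`, ★ CAYLEY ∕ ★ FILE A).  The CAYLEY LITERAL `t′ := ψ⁻¹ t_π(Y₁,Y₂,Y₃) ∈ G′_v` exists (★ FILE A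
`exists_mem_unitaryGroupOfForm_coe_eq_conj_diagonal` with the diagonal Gram matrix ★ `gram_flickerFrame_pi` of the frame `D_π h`), has the SAME eigenframe
`Q = Tl⁻¹ D_π h` as `t`, and in that frame `X = 1 + ϖ⁻¹(t_w − 1) = Q·diag(1 + ϖ⁻¹(x−1))·Q⁻¹`, `Y = Q·diag(Y)·Q⁻¹`, `Y⁻¹ = Q·diag(Y⁻¹)·Q⁻¹` generate one order
(★ `span_pow_one_add_eq` ∘ ★ `span_pow_shift_eq_span_pow_cayleyParam` ∘ ★ `span_pow_cayleyParam_eq_span_pow_cayley`, ★ `cayley_inv_mem_span_pow`, matrix bridge ★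
`conj_diagonal_mem_adjoin_of_mem_span_pow`).  Hence (★ ROW-0 = `#Fix(Y)` p846223) `n₀(t) = #Fix_{t′}(G′_v ⧸ K_v)` (★ `natCard_fixedCosets_eq` along ★ `localNonsplitEquiv`)
`= φ₁(Q₁ − 1, P − 1)` (★ `natCard_fixedBy_cmLocalIntegralLevel_eq_of_congr` ∘ ★ `natCard_fixedPoints_unitaryInt_corner_eq_phiOne_adicCompletion` at `t′`); the θ̄ = 0
literal `t_1` is the same with the frame `h` (★ `gram_flickerFrame`) and ★ `…_eq_phiZero_adicCompletion`.

FILE C of three (★ FILE A `SplitTorusCayleyShiftValued`: generic algebra; ★ FILE B `DepthZeroKappaTransferCayleyLiteral`: the CM frame and the core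
`exists_cayley_literal_of_congr_conj_diagonal`).  Here the two heads: **`ncard_rankStratum_zero_eq_phiOne_of_congr`** (θ̄ = 1: `(n₀(t) : ℚ) = φ₁(q_v; Q₁ − 1, P − 1)`,
frame `D_π h`, ★ `gram_flickerFrame_pi`, count ★ `natCard_fixedPoints_unitaryInt_corner_eq_phiOne_adicCompletion` at the Cayley literal) and
**`ncard_rankStratum_zero_eq_phiZero_of_congr`** (θ̄ = 0: `= φ₀(q_v; Q₁ − 1, Q₂ − 1, P − 1)`, frame `h`, ★ `gram_flickerFrame`, count ★ `…_eq_phiZero_adicCompletion`), binders =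
★ p846155's unit rows `sum_ncard_rankStrata_eq_phiOne∕phiZero_of_congr` VERBATIM (`1 ≤ P, Q₁, Q₂` are DERIVED from `hd₁ hd₂ hd₃`, ★ FILE A `one_le_of_valued_sub_eq_exp_neg`).

HONEST LABEL: HC_CM is proved only modulo the 2 remaining named inputs (hLiu418 24832, h413 24833) until rung 0 closes; this file is count-neutral.

## References
* [Rogawski1990] J. D. Rogawski, *Automorphic Representations of Unitary Groups in Three Variables* (1990), §4.9 p. 54, Prop. 4.9.1 (b) p. 55, §14.2 p. 233.
* [Kottwitz1986] R. E. Kottwitz, *Base change for unit elements of Hecke algebras*, Compositio Math. 60 (1986), §3 (the level recursion of the fixed-vertex counts).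
* [Flicker1998UnitaryFL] Y. Z. Flicker, *Elementary proof of the fundamental lemma for a unitary group*, Canad. J. Math. 50 (1998), §1 p. 76, Prop. 3 p. 78, Prop. 11 p. 87, Prop. 14 p. 94.
-/

set_option autoImplicit false

noncomputable section

open MeasureTheory Measure Set Function NumberField IsDedekindDomain Matrix Polynomial
open Literature.NumberTheory.Automorphic Literature.NumberTheory.Automorphic.UnitaryGroup
open Literature.NumberTheory.Automorphic.IntegralReduction Literature.NumberTheory.GaloisRepresentations
open Literature.NumberTheory.Automorphic.HermitianLattice (unitaryInt)
open scoped Matrix MatrixGroups ValuativeRel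

namespace Literature.NumberTheory.Rogawski1990
/-! ## §3 The heads: ROW 0 at the θ̄ = 1 literals `t_π` and at the θ̄ = 0 literal `t_1` -/

section Heads

variable (L : Type) [Field L] [NumberField L] [IsCMField L] (H' : Matrix (Fin 3) (Fin 3) L)
  {v : HeightOneSpectrum (𝓞 ↥(maximalRealSubfield L))}

set_option synthInstance.maxHeartbeats 200000 in  -- the coset action `U_w ↷ U_w ⧸ unitaryInt` (as in ★ `FixedCosetsTransport`)
set_option maxHeartbeats 400000 in  -- the heavy one-place carriers
open scoped Classical in
/-- **ROW 0 AT A θ̄ = 1 LITERAL (measure-free)**: for `t ∈ G′_v` congruent to `t_π(x₁,x₂,x₃)` with `x_i` pairwise distinct of norm one and ≡ 1 (mod 𝔪_w), `P = ord_w(x₁ − x₃)`,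
`Q₁ = ord_w(x₁ − x₂)`, the residually trivial stratum of `Fix_t(G′_v ⧸ K_v)` (`rank(red(q⁻¹ t q)_w − 1) = 0`, the `n₀(t)` of ★ `classOrbitalIntegral_eq_mul_strata_three_of_deep`) has
**`n₀(t) = φ₁(Q₁ − 1, P − 1)`** — Flicker's θ̄ = 1 count at the exponents lowered by one (the Cayley literal `t′` of §2 is again a `t_π`-literal, counted by ★
`natCard_fixedPoints_unitaryInt_corner_eq_phiOne_adicCompletion`).  Binders = ★ `sum_ncard_rankStrata_eq_phiOne_of_congr` VERBATIM.
[cite: Rogawski1990, §4.9 p. 54, Prop. 4.9.1 (b) p. 55] [cite: Kottwitz1986, §3] [cite: Flicker1998UnitaryFL, Prop. 11 p. 87] -/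
theorem ncard_rankStratum_zero_eq_phiOne_of_congr
    (hH' : (H'.map (IsCMField.complexConj L))ᵀ = H') (hH'u : IsUnit H') (w : PlacesOver L v)
    (hw : IsCMField.complexConj L • w.1 = w.1) (hv : Algebra.IsUnramifiedIn (𝓞 L) v.asIdeal)
    (h2 : IsUnit (2 : 𝒪[w.1.adicCompletion L]))
    {e π π' y x₁ x₂ x₃ : LocalRing L v} (h2e : 2 * e = 1) (hσπ : conjLocal L (IsCMField.complexConj L) v π = π) (hππ : π * π' = 1)
    (hπN : ∀ z : LocalRing L v, conjLocal L (IsCMField.complexConj L) v z * z ≠ π)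
    (hy : conjLocal L (IsCMField.complexConj L) v y * y = -2)
    (hx₁ : conjLocal L (IsCMField.complexConj L) v x₁ * x₁ = 1) (hx₂ : conjLocal L (IsCMField.complexConj L) v x₂ * x₂ = 1)
    (hx₃ : conjLocal L (IsCMField.complexConj L) v x₃ * x₃ = 1) (h₁₂ : x₁ ≠ x₂) (h₂₃ : x₂ ≠ x₃) (h₁₃ : x₁ ≠ x₃)
    (Tl : GL (Fin 3) (LocalRing L v))
    (ψ : ↥(UnitaryGroup.«local» L (IsCMField.complexConj L) 3 H' v) ≃ₜ*
        ↥(UnitaryGroup.«local» L (IsCMField.complexConj L) 3 (Matrix.of fun i j : Fin 3 => if i.val + j.val + 1 = 3 then (1 : L) else 0) v))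
    (t : (cmDatum L 3 H').Local v)
    (hψ : ∀ g, (ψ g).val = Tl * g.val * Tl⁻¹)
    (hlev : ∀ g, g ∈ cmLocalIntegralLevel L 3 H' v ↔
        ψ g ∈ cmLocalIntegralLevel L 3 (Matrix.of fun i j : Fin 3 => if i.val + j.val + 1 = 3 then (1 : L) else 0) v)
    (hlit : (ψ t).val.val =
          !![e * (x₁ + x₃), 0, -(e * (x₁ - x₃) * π); 0, x₂, 0; -(e * (x₁ - x₃) * π'), 0, e * (x₁ + x₃)])
    {P Q₁ Q₂ : ℕ} (hP : Valued.v (x₁ w - x₃ w) = WithZero.exp (-(P : ℤ))) (hQ₁ : Valued.v (x₁ w - x₂ w) = WithZero.exp (-(Q₁ : ℤ)))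
    (hQ₂ : Valued.v (x₃ w - x₂ w) = WithZero.exp (-(Q₂ : ℤ)))
    (hd₁ : Valued.v (x₁ w - 1) < 1) (hd₂ : Valued.v (x₂ w - 1) < 1) (hd₃ : Valued.v (x₃ w - 1) < 1) :
    (({q : (cmDatum L 3 H').Local v ⧸ cmLocalIntegralLevel L 3 H' v |
        q ∈ MulAction.fixedBy ((cmDatum L 3 H').Local v ⧸ cmLocalIntegralLevel L 3 H' v) t ∧
          (redMat ((((q.out⁻¹ * t * q.out : (cmDatum L 3 H').Local v)).val : GL (Fin 3) (LocalRing L v)).val.map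
            (Pi.evalRingHom (fun w' : PlacesOver L v => w'.1.adicCompletion L) w)) - 1).rank = 0}.ncard : ℕ) : ℚ) =
      Flicker1998.phiOne (Ideal.absNorm v.asIdeal) (Q₁ - 1) (P - 1) := by
  have hc1 : IsCMField.complexConj L ≠ 1 := IsCMField.complexConj_ne_one L
  haveI : IsAdicComplete (IsLocalRing.maximalIdeal (Valued.integer (w.1.adicCompletion L))) (Valued.integer (w.1.adicCompletion L)) :=
    isAdicComplete_maximalIdeal_valuedInteger_adicCompletion L w.1
  haveI : Algebra.IsQuadraticExtension ↥(maximalRealSubfield L) L := IsCMField.isQuadraticExtension L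
  -- silence the unused distinctness binders (kept VERBATIM from ★ the unit row; the Cayley eigenvalues are separated by `hP hQ₁ hQ₂`)
  have _h : x₁ ≠ x₂ ∧ x₂ ≠ x₃ ∧ x₁ ≠ x₃ := ⟨h₁₂, h₂₃, h₁₃⟩
  -- the frame `D_π h` and its Gram matrix
  set P₁ : GL (Fin 3) (LocalRing L v) := ⟨_, _, Flicker1998.flickerFramePi_mul_inv h2e hππ, Flicker1998.flickerFramePiInv_mul h2e hππ⟩ with hP₁def
  have hG : ((P₁.val : Matrix (Fin 3) (Fin 3) (LocalRing L v)).map (conjLocal L (IsCMField.complexConj L) v))ᵀ *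
      (Matrix.of fun i j : Fin 3 => if i.val + j.val + 1 = 3 then (1 : LocalRing L v) else 0) * P₁.val = diagonal ![-2 * π, 1, 2 * π] := by
    rw [Flicker1998.diagonal_fin_three]
    exact Flicker1998.gram_flickerFrame_pi (conjLocal L (IsCMField.complexConj L) v) hσπ
  have hlitP : (ψ t).val.val = P₁.val * diagonal ![x₁, x₂, x₃] * (P₁⁻¹).val := by
    rw [hlit, Flicker1998.literal_pi_eq_conj_diagonal hππ, ← Flicker1998.diagonal_fin_three x₁ x₂ x₃]; rfl
  obtain ⟨Y₁, Y₂, Y₃, t', hlit', hY₁, hY₂, hY₃, hP', hQ₁', hQ₂', hfin, hn₀⟩ :=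
    exists_cayley_literal_of_congr_conj_diagonal L H' hH' hH'u w hw hv h2 hx₁ hx₂ hx₃ Tl ψ t hψ hlev P₁ hG hlitP hP hQ₁ hQ₂ hd₁ hd₂ hd₃
  -- the Cayley literal IS a `t_π`-literal, read at `w`
  have hlit'' : (ψ t').val.val = !![e * (Y₁ + Y₃), 0, -(e * (Y₁ - Y₃) * π); 0, Y₂, 0; -(e * (Y₁ - Y₃) * π'), 0, e * (Y₁ + Y₃)] := by
    rw [hlit', Flicker1998.literal_pi_eq_conj_diagonal hππ, ← Flicker1998.diagonal_fin_three Y₁ Y₂ Y₃]; rfl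
  have hte : (((localNonsplitEquiv (IsCMField.complexConj L) (Matrix.of fun i j : Fin 3 => if i.val + j.val + 1 = 3 then (1 : L) else 0) hc1 w hw (ψ t') :
        unitaryGroupOfForm (galAdicCompletionMap (L := L) (IsCMField.complexConj L) hw)
          (placeForm (Matrix.of fun i j : Fin 3 => if i.val + j.val + 1 = 3 then (1 : L) else 0) w.1)) :
        GL (Fin 3) (w.1.adicCompletion L)) : Matrix (Fin 3) (Fin 3) (w.1.adicCompletion L)) =
      !![e w * (Y₁ w + Y₃ w), 0, -(e w * (Y₁ w - Y₃ w) * π w); 0, Y₂ w, 0; -(e w * (Y₁ w - Y₃ w) * π' w), 0, e w * (Y₁ w + Y₃ w)] := by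
    rw [coe_coe_localNonsplitEquiv_apply, hlit'']
    ext i j
    fin_cases i <;> fin_cases j <;> rfl
  -- the data at `w`
  have h2L : (2 : 𝓞 L) ∉ w.1.asIdeal := by
    have h2w : Valued.v (2 : w.1.adicCompletion L) = 1 := (isUnit_two_integer_iff_valued_eq_one L w.1).1 h2
    have e1 : (algebraMap L (w.1.adicCompletion L)) (algebraMap (𝓞 L) L 2) = 2 := by rw [map_ofNat, map_ofNat]
    rw [← e1] at h2w
    change Valued.v ((algebraMap (𝓞 L) L 2 : L) : w.1.adicCompletion L) = 1 at h2w
    rw [HeightOneSpectrum.valuedAdicCompletion_eq_valuation', HeightOneSpectrum.valuation_of_algebraMap] at h2w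
    exact HeightOneSpectrum.intValuation_eq_one_iff.1 h2w
  have h2F : (2 : 𝓞 ↥(maximalRealSubfield L)) ∉ v.asIdeal := by
    intro hmem
    apply h2L
    have h := congrArg HeightOneSpectrum.asIdeal w.2
    rw [← h] at hmem
    simp only [HeightOneSpectrum.under_asIdeal, Ideal.under_def, Ideal.mem_comap, map_ofNat] at hmem
    exact hmem
  have hσw : ∀ z : LocalRing L v, conjLocal L (IsCMField.complexConj L) v z w = galAdicCompletionMap (L := L) (IsCMField.complexConj L) hw (z w) :=
    fun z => conjLocal_apply_eq_of_smul_eq (IsCMField.complexConj L) hc1 v w hw z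
  have hyw : y w * galAdicCompletionMap (L := L) (IsCMField.complexConj L) hw (y w) = -2 := by
    rw [← hσw, mul_comm]; exact (congrFun hy w : _)
  have h2ew : 2 * e w = 1 := by
    have := congrFun h2e w; simpa using this
  have hσπw : galAdicCompletionMap (L := L) (IsCMField.complexConj L) hw (π w) = π w := by
    rw [← hσw]; exact (congrFun hσπ w : _)
  have hππw : π w * π' w = 1 := by
    have := congrFun hππ w; simpa using this
  have hπNw : ∀ z : w.1.adicCompletion L, galAdicCompletionMap (L := L) (IsCMField.complexConj L) hw z * z ≠ π w := by
    intro z hz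
    haveI : Subsingleton (PlacesOver L v) := PlacesOver.subsingleton_of_smul_eq (IsCMField.complexConj L) hc1 w hw
    letI : Unique (PlacesOver L v) := uniqueOfSubsingleton w
    let πe : LocalRing L v ≃+* w.1.adicCompletion L := RingEquiv.piUnique fun w' : PlacesOver L v => w'.1.adicCompletion L
    have hz' : πe.symm z w = z := πe.apply_symm_apply z
    refine hπN (πe.symm z) (πe.injective ?_)
    show (conjLocal L (IsCMField.complexConj L) v (πe.symm z) * πe.symm z) w = π w
    rw [Pi.mul_apply, hσw, hz', hz]
  rw [hn₀]
  exact natCard_fixedPoints_unitaryInt_corner_eq_phiOne_adicCompletion L w hw hv h2F hyw h2ew hY₁ hY₂ hY₃ hσπw hππw hπNw hte hP' hQ₁' hQ₂' hfin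

set_option synthInstance.maxHeartbeats 200000 in  -- the coset action `U_w ↷ U_w ⧸ unitaryInt` (as in ★ `FixedCosetsTransport`)
set_option maxHeartbeats 400000 in  -- the heavy one-place carriers
open scoped Classical in
/-- **ROW 0 AT THE θ̄ = 0 LITERAL (measure-free)**: for `t ∈ G′_v` congruent to `t_1(x₁,x₂,x₃)` with `x_i` pairwise distinct of norm one and ≡ 1 (mod 𝔪_w), exponents
`P, Q₁, Q₂` (two equal, not exceeding the third): **`n₀(t) = φ₀(Q₁ − 1, Q₂ − 1, P − 1)`** — Flicker's θ̄ = 0 count (★ X₁ `natCard_fixedPoints_unitaryInt_corner_eq_phiZero_adicCompletion`)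
at the exponents lowered by one (the Cayley literal of §2 with the frame `h`, ★ `gram_flickerFrame`).  Binders = ★ `sum_ncard_rankStrata_eq_phiZero_of_congr` VERBATIM.
[cite: Rogawski1990, §4.9 p. 54, Prop. 4.9.1 (b) p. 55] [cite: Kottwitz1986, §3] [cite: Flicker1998UnitaryFL, Prop. 14 p. 94] -/
theorem ncard_rankStratum_zero_eq_phiZero_of_congr
    (hH' : (H'.map (IsCMField.complexConj L))ᵀ = H') (hH'u : IsUnit H') (w : PlacesOver L v)
    (hw : IsCMField.complexConj L • w.1 = w.1) (hv : Algebra.IsUnramifiedIn (𝓞 L) v.asIdeal)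
    (h2 : IsUnit (2 : 𝒪[w.1.adicCompletion L]))
    {e y x₁ x₂ x₃ : LocalRing L v} (h2e : 2 * e = 1)
    (hy : conjLocal L (IsCMField.complexConj L) v y * y = -2)
    (hx₁ : conjLocal L (IsCMField.complexConj L) v x₁ * x₁ = 1) (hx₂ : conjLocal L (IsCMField.complexConj L) v x₂ * x₂ = 1)
    (hx₃ : conjLocal L (IsCMField.complexConj L) v x₃ * x₃ = 1) (h₁₂ : x₁ ≠ x₂) (h₂₃ : x₂ ≠ x₃) (h₁₃ : x₁ ≠ x₃)
    (Tl : GL (Fin 3) (LocalRing L v))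
    (ψ : ↥(UnitaryGroup.«local» L (IsCMField.complexConj L) 3 H' v) ≃ₜ*
        ↥(UnitaryGroup.«local» L (IsCMField.complexConj L) 3 (Matrix.of fun i j : Fin 3 => if i.val + j.val + 1 = 3 then (1 : L) else 0) v))
    (t : (cmDatum L 3 H').Local v)
    (hψ : ∀ g, (ψ g).val = Tl * g.val * Tl⁻¹)
    (hlev : ∀ g, g ∈ cmLocalIntegralLevel L 3 H' v ↔
        ψ g ∈ cmLocalIntegralLevel L 3 (Matrix.of fun i j : Fin 3 => if i.val + j.val + 1 = 3 then (1 : L) else 0) v)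
    (hlit : (ψ t).val.val =
          !![e * (x₁ + x₃), 0, -(e * (x₁ - x₃)); 0, x₂, 0; -(e * (x₁ - x₃)), 0, e * (x₁ + x₃)])
    {P Q₁ Q₂ : ℕ} (hP : Valued.v (x₁ w - x₃ w) = WithZero.exp (-(P : ℤ))) (hQ₁ : Valued.v (x₁ w - x₂ w) = WithZero.exp (-(Q₁ : ℤ)))
    (hQ₂ : Valued.v (x₃ w - x₂ w) = WithZero.exp (-(Q₂ : ℤ)))
    (htri : (Q₁ = Q₂ ∧ Q₁ ≤ P) ∨ (Q₁ = P ∧ Q₁ ≤ Q₂) ∨ (Q₂ = P ∧ Q₂ ≤ Q₁))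
    (hd₁ : Valued.v (x₁ w - 1) < 1) (hd₂ : Valued.v (x₂ w - 1) < 1) (hd₃ : Valued.v (x₃ w - 1) < 1) :
    (({q : (cmDatum L 3 H').Local v ⧸ cmLocalIntegralLevel L 3 H' v |
        q ∈ MulAction.fixedBy ((cmDatum L 3 H').Local v ⧸ cmLocalIntegralLevel L 3 H' v) t ∧
          (redMat ((((q.out⁻¹ * t * q.out : (cmDatum L 3 H').Local v)).val : GL (Fin 3) (LocalRing L v)).val.map
            (Pi.evalRingHom (fun w' : PlacesOver L v => w'.1.adicCompletion L) w)) - 1).rank = 0}.ncard : ℕ) : ℚ) =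
      Flicker1998.phiZero (Ideal.absNorm v.asIdeal) (Q₁ - 1) (Q₂ - 1) (P - 1) := by
  have hc1 : IsCMField.complexConj L ≠ 1 := IsCMField.complexConj_ne_one L
  haveI : IsAdicComplete (IsLocalRing.maximalIdeal (Valued.integer (w.1.adicCompletion L))) (Valued.integer (w.1.adicCompletion L)) :=
    isAdicComplete_maximalIdeal_valuedInteger_adicCompletion L w.1
  haveI : Algebra.IsQuadraticExtension ↥(maximalRealSubfield L) L := IsCMField.isQuadraticExtension L
  have _h : x₁ ≠ x₂ ∧ x₂ ≠ x₃ ∧ x₁ ≠ x₃ := ⟨h₁₂, h₂₃, h₁₃⟩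
  -- the frame `h` and its Gram matrix
  set P₁ : GL (Fin 3) (LocalRing L v) := ⟨_, _, Flicker1998.flickerFrame_mul_inv h2e, Flicker1998.flickerFrameInv_mul h2e⟩ with hP₁def
  have hG : ((P₁.val : Matrix (Fin 3) (Fin 3) (LocalRing L v)).map (conjLocal L (IsCMField.complexConj L) v))ᵀ *
      (Matrix.of fun i j : Fin 3 => if i.val + j.val + 1 = 3 then (1 : LocalRing L v) else 0) * P₁.val = diagonal ![(-2 : LocalRing L v), 1, 2] := by
    rw [Flicker1998.diagonal_fin_three]
    exact Flicker1998.gram_flickerFrame (conjLocal L (IsCMField.complexConj L) v)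
  have hlitP : (ψ t).val.val = P₁.val * diagonal ![x₁, x₂, x₃] * (P₁⁻¹).val := by
    rw [hlit, Flicker1998.literal_one_eq_conj_diagonal e x₁ x₂ x₃, ← Flicker1998.diagonal_fin_three x₁ x₂ x₃]; rfl
  obtain ⟨Y₁, Y₂, Y₃, t', hlit', hY₁, hY₂, hY₃, hP', hQ₁', hQ₂', hfin, hn₀⟩ :=
    exists_cayley_literal_of_congr_conj_diagonal L H' hH' hH'u w hw hv h2 hx₁ hx₂ hx₃ Tl ψ t hψ hlev P₁ hG hlitP hP hQ₁ hQ₂ hd₁ hd₂ hd₃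
  -- the Cayley literal IS a `t_1`-literal, read at `w`
  have hlit'' : (ψ t').val.val = !![e * (Y₁ + Y₃), 0, -(e * (Y₁ - Y₃)); 0, Y₂, 0; -(e * (Y₁ - Y₃)), 0, e * (Y₁ + Y₃)] := by
    rw [hlit', Flicker1998.literal_one_eq_conj_diagonal e Y₁ Y₂ Y₃, ← Flicker1998.diagonal_fin_three Y₁ Y₂ Y₃]; rfl
  have hte : (((localNonsplitEquiv (IsCMField.complexConj L) (Matrix.of fun i j : Fin 3 => if i.val + j.val + 1 = 3 then (1 : L) else 0) hc1 w hw (ψ t') :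
        unitaryGroupOfForm (galAdicCompletionMap (L := L) (IsCMField.complexConj L) hw)
          (placeForm (Matrix.of fun i j : Fin 3 => if i.val + j.val + 1 = 3 then (1 : L) else 0) w.1)) :
        GL (Fin 3) (w.1.adicCompletion L)) : Matrix (Fin 3) (Fin 3) (w.1.adicCompletion L)) =
      !![e w * (Y₁ w + Y₃ w), 0, -(e w * (Y₁ w - Y₃ w)); 0, Y₂ w, 0; -(e w * (Y₁ w - Y₃ w)), 0, e w * (Y₁ w + Y₃ w)] := by
    rw [coe_coe_localNonsplitEquiv_apply, hlit'']
    ext i j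
    fin_cases i <;> fin_cases j <;> rfl
  -- the data at `w`
  have h2L : (2 : 𝓞 L) ∉ w.1.asIdeal := by
    have h2w : Valued.v (2 : w.1.adicCompletion L) = 1 := (isUnit_two_integer_iff_valued_eq_one L w.1).1 h2
    have e1 : (algebraMap L (w.1.adicCompletion L)) (algebraMap (𝓞 L) L 2) = 2 := by rw [map_ofNat, map_ofNat]
    rw [← e1] at h2w
    change Valued.v ((algebraMap (𝓞 L) L 2 : L) : w.1.adicCompletion L) = 1 at h2w
    rw [HeightOneSpectrum.valuedAdicCompletion_eq_valuation', HeightOneSpectrum.valuation_of_algebraMap] at h2w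
    exact HeightOneSpectrum.intValuation_eq_one_iff.1 h2w
  have h2F : (2 : 𝓞 ↥(maximalRealSubfield L)) ∉ v.asIdeal := by
    intro hmem
    apply h2L
    have h := congrArg HeightOneSpectrum.asIdeal w.2
    rw [← h] at hmem
    simp only [HeightOneSpectrum.under_asIdeal, Ideal.under_def, Ideal.mem_comap, map_ofNat] at hmem
    exact hmem
  have hσw : ∀ z : LocalRing L v, conjLocal L (IsCMField.complexConj L) v z w = galAdicCompletionMap (L := L) (IsCMField.complexConj L) hw (z w) :=
    fun z => conjLocal_apply_eq_of_smul_eq (IsCMField.complexConj L) hc1 v w hw z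
  have hyw : y w * galAdicCompletionMap (L := L) (IsCMField.complexConj L) hw (y w) = -2 := by
    rw [← hσw, mul_comm]; exact (congrFun hy w : _)
  have h2ew : 2 * e w = 1 := by
    have := congrFun h2e w; simpa using this
  have h1P := one_le_of_valued_sub_eq_exp_neg hd₁ hd₃ hP
  have h1Q₁ := one_le_of_valued_sub_eq_exp_neg hd₁ hd₂ hQ₁
  have h1Q₂ := one_le_of_valued_sub_eq_exp_neg hd₃ hd₂ hQ₂
  have htri' : (Q₁ - 1 = Q₂ - 1 ∧ Q₁ - 1 ≤ P - 1) ∨ (Q₁ - 1 = P - 1 ∧ Q₁ - 1 ≤ Q₂ - 1) ∨ (Q₂ - 1 = P - 1 ∧ Q₂ - 1 ≤ Q₁ - 1) := by omega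
  rw [hn₀]
  exact natCard_fixedPoints_unitaryInt_corner_eq_phiZero_adicCompletion L w hw hv h2F hyw h2ew hY₁ hY₂ hY₃ hte hP' hQ₁' hQ₂' htri' hfin

end Heads

end Literature.NumberTheory.Rogawski1990

end
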